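import Summits.CriticalPhenomena.PercolationContinuityZ3.Theorems.Transplant.FKDoubleFanSesquiConeCut
import HarnessLib

/-!
# Double fans `K₂ ∨ P_{m+1}`: the local criterion for the dressed cone holds at the two FULLY DRESSED RAYS `e_zv`, `e_yv` — the first
# tangent certificates for `CrossPosD15` (one limit atom each)

Helper file (`--supports stmt-CriticalPhenomena-4575`), FK sub-lane `prim-bschramm-fk-3` (gen 43); builds on p205010 (kernel theorem, internal
audit signed; external expert review pending).  No named facts, no sorries; standard axioms.  Memo `bschramm/prim-bschramm-fk-3/FAR-CROSS-XVIII.md` §3.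

`…SesquiConeCross` (gen 43) shows `Hyp15A ∧ Hyp15B ⟺ CrossPosD15`: `⟪T_D β, ρ⟫ ≥ 0` for every `β` in the closure of the normalised dressed atoms and
every `ρ ∈ DualS15 q` with `⟪β, ρ⟫ = 0`; and at full-rank interior generators this is automatic (`T_D` is tangent to the decomposable variety), so the
content of the criterion sits on the relative boundary of the dressed families.  The most degenerate boundary points are the fully dressed rays:
`∧²BC_1·imgA q F w = a_zv·e_zv` and `∧²AC_1·imgB q G w = b_yv·e_yv`.  There `T_D e_zv = e_uv − e_xz + e_yv + 2e_zv` is NOT a finite non-negative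
combination of atoms plus a multiple of `e_zv` (LP over 30 612 structured atoms, kit j290012: infeasible at `q ∈ {1/5,1/2,4/5}`), but it is a LIMIT
direction: `e_uv − e_xz + e_yv` is exactly the `T_b`-weight-1 part of the cut bivector `a∧b = ⟨1,0,0,1,−1,−1,0,0,1,1⟩ ∈ cone15 q` (kit j290042: a single
tangent atom, `q`-independent), i.e. `∧²BC_{1−δ}(a∧b) = δ²(e_ux − e_xy) + δ(e_uv − e_xz + e_yv) + e_zv` (**`opBC_abBiv`**).  Hence the TANGENT CERTIFICATE
(**`pairH_nonneg_of_quadratic_curve`**: if `δ·A + δ²·B ≥ 0` for all `δ ∈ (0,1]` then `A ≥ 0`) gives **`crossPosD_ray_zv`**: for every `ρ ∈ DualS15 q`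
with `⟪e_zv, ρ⟫ = 0`, `⟪T_D e_zv, ρ⟫ ≥ 0` (`0 < q ≤ 1`); and symmetrically **`crossPosD_ray_yv`** via `∧²AC_{1−δ}(a∧b)` (`a∧b` is also the `b`-image
`imgB q (E_0 fanInit) BC_1`, **`abBiv_eq_imgB`**).  These are the `β = e_zv, e_yv` instances of `CrossPosD15 q` (both rays are normalised dressed atoms).
[folklore]
-/

noncomputable section

namespace Summit.CriticalPhenomena.PercolationContinuityZ3.Theorems

namespace FK

namespace ThreeApex

/-- **First-order argument for tangent certificates**: if `δ·A + δ²·B ≥ 0` for all `δ ∈ (0,1]`, then `A ≥ 0`. [folklore] -/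
theorem nonneg_of_quadratic_curve {A B : ℝ} (h : ∀ δ : ℝ, 0 < δ → δ ≤ 1 → 0 ≤ δ * A + δ ^ 2 * B) : 0 ≤ A := by
  by_contra hA; rw [not_le] at hA
  by_cases hB : B ≤ 0
  · have := h 1 one_pos le_rfl
    nlinarith
  · rw [not_le] at hB
    -- δ := min 1 (−A/(2B)) > 0: then δ A + δ² B ≤ δ (A + δ B) ≤ δ (A − A/2) < 0
    set δ : ℝ := min 1 (-A / (2 * B)) with hδ
    have hδ0 : 0 < δ := by rw [hδ]; exact lt_min one_pos (div_pos (by linarith) (by linarith))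
    have hδ1 : δ ≤ 1 := min_le_left _ _
    have hδB : δ * B ≤ -A / 2 := by
      have : δ ≤ -A / (2 * B) := min_le_right _ _
      calc δ * B ≤ -A / (2 * B) * B := mul_le_mul_of_nonneg_right this hB.le
        _ = -A / 2 := by field_simp
    have := h δ hδ0 hδ1
    have e : δ * A + δ ^ 2 * B = δ * (A + δ * B) := by ring
    rw [e] at this
    have : A + δ * B < 0 := by linarith
    nlinarith

/-- The `b`-spoke applied to the cut bivector: `∧²BC_y(a∧b) = (1−y)²(e_ux − e_xy) + (1−y)(e_uv − e_xz + e_yv) + e_zv`. [folklore] -/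
theorem opBC_abBiv (y : ℝ) :
    opBC y (⟨1, 0, 0, 1, -1, -1, 0, 0, 1, 1⟩ : Biv) =
      ⟨(1 - y) ^ 2, 0, 0, 1 - y, -(1 - y) ^ 2, -(1 - y), 0, 0, 1 - y, 1⟩ := by
  ext <;> simp [opBC, opTb, opWb, Biv.lin3, Biv.add, Biv.smul] <;> ring

/-- The `a`-spoke applied to the cut bivector: `∧²AC_x(a∧b) = (1−x)²(e_ux − e_xz) + (1−x)(e_uv − e_xy + e_zv) + e_yv`. [folklore] -/
theorem opAC_abBiv (x : ℝ) :
    opAC x (⟨1, 0, 0, 1, -1, -1, 0, 0, 1, 1⟩ : Biv) =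
      ⟨(1 - x) ^ 2, 0, 0, 1 - x, -(1 - x), -(1 - x) ^ 2, 0, 0, 1, 1 - x⟩ := by
  ext <;> simp [opAC, opTa, opWa, Biv.lin3, Biv.add, Biv.smul] <;> ring

/-- `T_D e_zv = e_uv − e_xz + e_yv + 2 e_zv`. [folklore] -/
theorem opTD_ezv (q : ℝ) : opTD q (⟨0, 0, 0, 0, 0, 0, 0, 0, 0, 1⟩ : Biv) = ⟨0, 0, 0, 1, 0, -1, 0, 0, 1, 2⟩ := by
  ext <;> simp [opTD]

/-- `T_D e_yv = e_uv − e_xy + 2 e_yv + e_zv`. [folklore] -/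
theorem opTD_eyv (q : ℝ) : opTD q (⟨0, 0, 0, 0, 0, 0, 0, 0, 1, 0⟩ : Biv) = ⟨0, 0, 0, 1, -1, 0, 0, 0, 2, 1⟩ := by
  ext <;> simp [opTD]

/-- The cut bivector is also a `b`-image: `a∧b = imgB q (E_0 fanInit) BC_1` (the cut gadget lies in both fan algebras). [folklore] -/
theorem abBiv_eq_imgB (q : ℝ) : (⟨1, 0, 0, 1, -1, -1, 0, 0, 1, 1⟩ : Biv) = imgB q (rimStep q 0 fanInit) (edgeBC 1) := by
  rw [fanInit_eq]
  ext <;> norm_num [imgB, fanComboB, wedgeH, conv, edgeAC, edgeBC, detach, rimStep, hx, hy, hz, V5.total]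

/-- **The local criterion at the fully `b`-dressed ray `e_zv`**: for every `ρ ∈ DualS15 q` with `⟪e_zv, ρ⟫ = 0`, `⟪T_D e_zv, ρ⟫ ≥ 0`
(`0 < q ≤ 1`; tangent certificate along `δ ↦ ∧²BC_{1−δ}(a∧b) ∈ cone15 q`). [folklore] -/
theorem crossPosD_ray_zv {q : ℝ} (hq0 : 0 < q) (hq1 : q ≤ 1) (ρ : Biv) (hρ : DualS15 q ρ)
    (h0 : pairH q (⟨0, 0, 0, 0, 0, 0, 0, 0, 0, 1⟩ : Biv) ρ = 0) :
    0 ≤ pairH q (opTD q (⟨0, 0, 0, 0, 0, 0, 0, 0, 0, 1⟩ : Biv)) ρ := by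
  have hab : InS q (rimStep q 0 fanInit) := ((fanInit_inKE q).inS hq0 hq1).rimStep hq0 hq1 le_rfl zero_le_one
  have hw : InS q (edgeBC 1) := (IsLetter.bc zero_le_one le_rfl).inS hq0 hq1
  -- the curve δ ↦ ⟪∧²BC_{1−δ}(a∧b), ρ⟫ = δ·⟪T_D e_zv − 2e_zv, ρ⟫ + δ²·⟪e_ux − e_xy, ρ⟫ ≥ 0
  have hcurve : ∀ δ : ℝ, 0 < δ → δ ≤ 1 →
      0 ≤ δ * pairH q (⟨0, 0, 0, 1, 0, -1, 0, 0, 1, 0⟩ : Biv) ρ + δ ^ 2 * pairH q (⟨1, 0, 0, 0, -1, 0, 0, 0, 0, 0⟩ : Biv) ρ := by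
    intro δ hδ0 hδ1
    have hmem := hρ.2.2 (rimStep q 0 fanInit) (edgeBC 1) (1 - δ) hab hw (by linarith) (by linarith)
    rw [← abBiv_eq_imgA, opBC_abBiv] at hmem
    have e : pairH q (⟨(1 - (1 - δ)) ^ 2, 0, 0, 1 - (1 - δ), -(1 - (1 - δ)) ^ 2, -(1 - (1 - δ)), 0, 0, 1 - (1 - δ), 1⟩ : Biv) ρ =
        δ * pairH q (⟨0, 0, 0, 1, 0, -1, 0, 0, 1, 0⟩ : Biv) ρ + δ ^ 2 * pairH q (⟨1, 0, 0, 0, -1, 0, 0, 0, 0, 0⟩ : Biv) ρ +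
          pairH q (⟨0, 0, 0, 0, 0, 0, 0, 0, 0, 1⟩ : Biv) ρ := by
      simp only [pairH]; ring
    rw [e, h0, add_zero] at hmem
    exact hmem
  have hA := nonneg_of_quadratic_curve hcurve
  rw [opTD_ezv]
  have e2 : pairH q (⟨0, 0, 0, 1, 0, -1, 0, 0, 1, 2⟩ : Biv) ρ =
      pairH q (⟨0, 0, 0, 1, 0, -1, 0, 0, 1, 0⟩ : Biv) ρ + 2 * pairH q (⟨0, 0, 0, 0, 0, 0, 0, 0, 0, 1⟩ : Biv) ρ := by
    simp only [pairH]; ring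
  rw [e2, h0]; linarith

/-- **The local criterion at the fully `a`-dressed ray `e_yv`**: for every `ρ ∈ DualS15 q` with `⟪e_yv, ρ⟫ = 0`, `⟪T_D e_yv, ρ⟫ ≥ 0`
(`0 < q ≤ 1`; tangent certificate along `δ ↦ ∧²AC_{1−δ}(a∧b)`, `a∧b` as a `b`-image). [folklore] -/
theorem crossPosD_ray_yv {q : ℝ} (hq0 : 0 < q) (hq1 : q ≤ 1) (ρ : Biv) (hρ : DualS15 q ρ)
    (h0 : pairH q (⟨0, 0, 0, 0, 0, 0, 0, 0, 1, 0⟩ : Biv) ρ = 0) :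
    0 ≤ pairH q (opTD q (⟨0, 0, 0, 0, 0, 0, 0, 0, 1, 0⟩ : Biv)) ρ := by
  have hab : InS q (rimStep q 0 fanInit) := ((fanInit_inKE q).inS hq0 hq1).rimStep hq0 hq1 le_rfl zero_le_one
  have hw : InS q (edgeBC 1) := (IsLetter.bc zero_le_one le_rfl).inS hq0 hq1
  have hcurve : ∀ δ : ℝ, 0 < δ → δ ≤ 1 →
      0 ≤ δ * pairH q (⟨0, 0, 0, 1, -1, 0, 0, 0, 0, 1⟩ : Biv) ρ + δ ^ 2 * pairH q (⟨1, 0, 0, 0, 0, -1, 0, 0, 0, 0⟩ : Biv) ρ := by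
    intro δ hδ0 hδ1
    have hmem := hρ.2.1 (rimStep q 0 fanInit) (edgeBC 1) (1 - δ) hab hw (by linarith) (by linarith)
    rw [← abBiv_eq_imgB, opAC_abBiv] at hmem
    have e : pairH q (⟨(1 - (1 - δ)) ^ 2, 0, 0, 1 - (1 - δ), -(1 - (1 - δ)), -(1 - (1 - δ)) ^ 2, 0, 0, 1, 1 - (1 - δ)⟩ : Biv) ρ =
        δ * pairH q (⟨0, 0, 0, 1, -1, 0, 0, 0, 0, 1⟩ : Biv) ρ + δ ^ 2 * pairH q (⟨1, 0, 0, 0, 0, -1, 0, 0, 0, 0⟩ : Biv) ρ +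
          pairH q (⟨0, 0, 0, 0, 0, 0, 0, 0, 1, 0⟩ : Biv) ρ := by
      simp only [pairH]; ring
    rw [e, h0, add_zero] at hmem
    exact hmem
  have hA := nonneg_of_quadratic_curve hcurve
  rw [opTD_eyv]
  have e2 : pairH q (⟨0, 0, 0, 1, -1, 0, 0, 0, 2, 1⟩ : Biv) ρ =
      pairH q (⟨0, 0, 0, 1, -1, 0, 0, 0, 0, 1⟩ : Biv) ρ + 2 * pairH q (⟨0, 0, 0, 0, 0, 0, 0, 0, 1, 0⟩ : Biv) ρ := by
    simp only [pairH]; ring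
  rw [e2, h0]; linarith

end ThreeApex

end FK

end Summit.CriticalPhenomena.PercolationContinuityZ3.Theorems
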